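import Literature.Analysis.FluidPDE.SelfSimilarEulerBernoulliSuperlevelTools
import HarnessLib

/-!
# Self-similar Euler profiles in the window `γ < ½`: the vorticity vanishes on every Bernoulli
# superlevel set whose stagnation points have stretching `< 1`

Analysis/FluidPDE proofs file (theorems only), third part of the Eulerian treatment of
Constantin–Ignatova–Vicol's Thm 3.10 (arXiv:2602.17570, §3.5) begun in
`SelfSimilarEulerOutgoingExclusion.lean` / `SelfSimilarEulerStagnationStretching.lean`. The
self-similar Bernoulli function `ℋ = ½|V|² + P + ½γ(γ−1)|y − c|²` (CIV (3.30)) is a Lyapunov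
function of the self-similar Lagrangian flow, `V·∇ℋ = (2γ−1)|V|² ≤ 0` for `γ < ½` (CIV (3.31),
tree `fderiv_selfSimilarBernoulli_transport`); hence a cutoff `χ(ℋ)` with `χ` NONDECREASING has
`(V·∇)χ(ℋ) ≤ 0` — the same good sign as the exterior radial cutoff — and the weighted `L^{2a}`
vorticity identity LOCALISES to superlevel sets `{ℋ > t}`:

> **Theorem** (`IsSelfSimilarEulerProfile.curl_eq_zero_on_bernoulliSuperlevel`). Let `0 < γ < ½`,
> `(U, P)` a `C²` stationary self-similar Euler profile (CIV (3.3)) whose radial transport is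
> eventually outward (`⟪V(y), y − c⟫ ≥ 0` for `|y − c| ≥ R₀`; e.g. under the far field (3.8)). Let
> `t ∈ ℝ`. If every stagnation point `z` of `V` with `ℋ(z) ≥ t` has stretching rates
> `⟪DU(z) w, w⟫ ≤ θ₀|w|²` for one `θ₀ < 1`, then `curl U ≡ 0` on `{ℋ > t}`.

So the vorticity of an in-window profile is confined BELOW the top Bernoulli level of its "bad"
stagnation points (those where the strain has an eigenvalue `≥ 1`, cf.
`exists_stagnation_stretching_ge_one`): the flow is irrotational — hence, being incompressible,
harmonic — on the Bernoulli cap above them.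

* (tools file `SelfSimilarEulerBernoulliSuperlevelTools`:
  `IsSelfSimilarEulerVorticityProfile.curl_eq_zero_of_weight_of_antitone` — the weighted `L^{2a}`
  identity with an extra `C¹` factor `ω ≥ 0`, `Dω[V] ≤ 0`, conclusion on `{ω > 0}`);
* `IsSelfSimilarEulerProfile.curl_eq_zero_on_bernoulliSuperlevel` — the theorem, with
  `ω = smoothTransition(ℋ − t)`; `…_of_hasSelfSimilarFarField` — the same under (3.8) with the
  POINTWISE hypothesis `⟪DU(z) w, w⟫ < |w|²` (`w ≠ 0`) at the stagnation points in `{ℋ ≥ t}`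
  (compactness of that set).

WHAT THIS IS NOT: nothing is claimed below the level `t`; in particular an in-window profile may
carry vorticity on and below the Bernoulli level of a stagnation point with unit stretching.

## References

* P. Constantin, M. Ignatova, V. Vicol, arXiv:2602.17570 (2026), §3.4.3 (3.30)–(3.33), §3.5
  Thm. 3.10. [ConstantinIgnatovaVicol2026Putative]
-/

noncomputable section

open MeasureTheory Set Filter Function Topology InnerProductSpace Metric
open scoped RealInnerProductSpace NNReal

namespace Literature.Analysis.FluidPDE

/-! ### Localisation to Bernoulli superlevel sets -/

namespace IsSelfSimilarEulerProfile

variable {γ : ℝ} {c : EuclideanSpace ℝ (Fin 3)}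
  {U : EuclideanSpace ℝ (Fin 3) → EuclideanSpace ℝ (Fin 3)} {P : EuclideanSpace ℝ (Fin 3) → ℝ}

/-- **The vorticity vanishes on every Bernoulli superlevel set whose stagnation points have
stretching below one.** Let `0 < γ < ½` and `(U, P)` a `C²` profile (CIV (3.3)) whose radial
transport is eventually outward (`⟪V(y), y − c⟫ ≥ 0` for `|y − c| ≥ R₀`). Let `t ∈ ℝ` and suppose
`⟪DU(z) w, w⟫ ≤ θ₀|w|²` (one `θ₀ < 1`, all `w`) at every stagnation point `z` of `V` with
`ℋ(z) ≥ t`, `ℋ` the self-similar Bernoulli function. Then `curl U = 0` on `{ℋ > t}`. Proof: the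
weighted identity `curl_eq_zero_of_weight_of_antitone` with `ψ = λℋ` and the flow-monotone cutoff
`ω = smoothTransition(ℋ − t)` (`Dω[V] = θ'·(2γ−1)|V|² ≤ 0`); near the good nodes a large exponent,
on the compact `B̄(c,2R) ∩ {ℋ ≥ t} ∖ D` (free of stagnation points) a large `λ`.
[cite: ConstantinIgnatovaVicol2026Putative, §3.5 Thm. 3.10 (proof, sharpened and localised)] -/
theorem curl_eq_zero_on_bernoulliSuperlevel (h : IsSelfSimilarEulerProfile γ c U P)
    (hγ : 0 < γ) (hγ2 : γ < 1 / 2) (t : ℝ) {θ₀ : ℝ} (hθ₀ : θ₀ < 1)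
    (hnode : ∀ z ∈ selfSimilarNodalSet γ c U, t ≤ selfSimilarBernoulli γ c U P z →
      ∀ w : EuclideanSpace ℝ (Fin 3), ⟪fderiv ℝ U z w, w⟫ ≤ θ₀ * ‖w‖ ^ 2)
    {R₀ : ℝ} (hR₀ : 0 < R₀)
    (hfarout : ∀ y, R₀ ≤ ‖y - c‖ → 0 ≤ ⟪selfSimilarTransport γ c U y, y - c⟫) :
    ∀ y, t < selfSimilarBernoulli γ c U P y → curl U y = 0 := by
  classical
  have hU2 : ContDiff ℝ 2 U := h.contDiff_velocity
  have hUd : Differentiable ℝ U := hU2.differentiable (by norm_num)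
  have hDUc : Continuous (fderiv ℝ U) := hU2.continuous_fderiv (by norm_num)
  have hVp := h.isSelfSimilarEulerVorticityProfile
  set V : EuclideanSpace ℝ (Fin 3) → EuclideanSpace ℝ (Fin 3) := selfSimilarTransport γ c U
    with hVdef
  have hVc : Continuous V := by
    have : Continuous fun y : EuclideanSpace ℝ (Fin 3) => γ • (y - c) + U y :=
      ((continuous_id.sub continuous_const).const_smul γ).add hU2.continuous
    exact this
  set Hb : EuclideanSpace ℝ (Fin 3) → ℝ := selfSimilarBernoulli γ c U P with hHbdef
  have hH1 : ContDiff ℝ 1 Hb := h.contDiff_selfSimilarBernoulli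
  have hHc : Continuous Hb := hH1.continuous
  set N : Set (EuclideanSpace ℝ (Fin 3)) :=
    {z | z ∈ selfSimilarNodalSet γ c U ∧ t ≤ Hb z} with hNdef
  replace hnode : ∀ z ∈ N, ∀ w : EuclideanSpace ℝ (Fin 3),
      ⟪fderiv ℝ U z w, w⟫ ≤ θ₀ * ‖w‖ ^ 2 := fun z hz w => hnode z hz.1 hz.2 w
  -- (1) a neighbourhood `D` of the nodal set where `⟪DU w, w⟫ ≤ θ|w|²`, `θ = (1+θ₀)/2 < 1`
  set θ : ℝ := (1 + θ₀) / 2 with hθdef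
  have hθ1 : θ < 1 := by rw [hθdef]; linarith
  have hrad : ∀ z ∈ N, ∃ r : ℝ, 0 < r ∧ ∀ y, dist y z < r →
      ∀ w : EuclideanSpace ℝ (Fin 3), ⟪fderiv ℝ U y w, w⟫ ≤ θ * ‖w‖ ^ 2 := by
    intro z hz
    have hδ : 0 < (1 - θ₀) / 2 := by linarith
    obtain ⟨r, hr, hball⟩ := Metric.continuousAt_iff.1 (hDUc.continuousAt (x := z)) _ hδ
    refine ⟨r, hr, fun y hy w => ?_⟩
    have hn : ‖fderiv ℝ U y - fderiv ℝ U z‖ < (1 - θ₀) / 2 := by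
      rw [← dist_eq_norm]; exact hball hy
    have h1 : ⟪(fderiv ℝ U y - fderiv ℝ U z) w, w⟫ ≤ (1 - θ₀) / 2 * ‖w‖ ^ 2 := by
      calc ⟪(fderiv ℝ U y - fderiv ℝ U z) w, w⟫
          ≤ ‖(fderiv ℝ U y - fderiv ℝ U z) w‖ * ‖w‖ := real_inner_le_norm _ _
        _ ≤ ‖fderiv ℝ U y - fderiv ℝ U z‖ * ‖w‖ * ‖w‖ :=
            mul_le_mul_of_nonneg_right (ContinuousLinearMap.le_opNorm _ _) (norm_nonneg _)
        _ ≤ (1 - θ₀) / 2 * ‖w‖ * ‖w‖ := by gcongr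
        _ = (1 - θ₀) / 2 * ‖w‖ ^ 2 := by ring
    have h2 := hnode z hz w
    have e : ⟪fderiv ℝ U y w, w⟫ = ⟪fderiv ℝ U z w, w⟫ + ⟪(fderiv ℝ U y - fderiv ℝ U z) w, w⟫ := by
      rw [show (fderiv ℝ U y - fderiv ℝ U z) w = fderiv ℝ U y w - fderiv ℝ U z w from rfl,
        inner_sub_left]
      ring
    rw [e, hθdef]
    linarith
  choose! r hr hrD using hrad
  set D : Set (EuclideanSpace ℝ (Fin 3)) := ⋃ z ∈ N, ball z (r z) with hDdef
  have hDo : IsOpen D := isOpen_biUnion fun z _ => isOpen_ball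
  have hND : N ⊆ D := fun z hz => mem_biUnion hz (mem_ball_self (hr z hz))
  have hDθ : ∀ y ∈ D, ∀ w : EuclideanSpace ℝ (Fin 3), ⟪fderiv ℝ U y w, w⟫ ≤ θ * ‖w‖ ^ 2 := by
    intro y hy w
    obtain ⟨z, hz, hyz⟩ := mem_iUnion₂.1 hy
    exact hrD z hz y (mem_ball.1 hyz) w
  set a : ℝ := 1 + (3 * γ + 1) / (2 * (1 - θ)) with hadef
  have ha1 : 1 ≤ a := by
    rw [hadef]
    have : 0 ≤ (3 * γ + 1) / (2 * (1 - θ)) := by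
      apply div_nonneg <;> linarith
    linarith
  have haθ : 2 * a * (θ - 1) + 3 * γ ≤ -1 := by
    have h1θ : 0 < 1 - θ := by linarith
    have hne : 2 * (1 - θ) ≠ 0 := by positivity
    have e : 2 * a * (1 - θ) = 2 * (1 - θ) + (3 * γ + 1) := by
      calc 2 * a * (1 - θ) = 2 * (1 - θ) + (3 * γ + 1) / (2 * (1 - θ)) * (2 * (1 - θ)) := by
            rw [hadef]; ring
        _ = 2 * (1 - θ) + (3 * γ + 1) := by rw [div_mul_cancel₀ _ hne]
    nlinarith
  -- (4) for every radius `R ≥ R₀`, `Ω = 0` on `B̄(c, R)`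
  have hHd : ∀ y, DifferentiableAt ℝ Hb y := fun y => hH1.differentiable one_ne_zero y
  have hHV : ∀ y, fderiv ℝ Hb y (V y) = (2 * γ - 1) * ‖V y‖ ^ 2 := fun y => by
    rw [hHbdef, hVdef]; exact h.fderiv_selfSimilarBernoulli_transport y
  -- the flow-monotone cutoff `ω = smoothTransition (ℋ − t)`
  set ω : EuclideanSpace ℝ (Fin 3) → ℝ := fun y => Real.smoothTransition (Hb y - t) with hωdef
  have hω1 : ContDiff ℝ 1 ω :=
    (Real.smoothTransition.contDiff (n := 1)).comp (hH1.sub contDiff_const)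
  have hω0 : ∀ y, 0 ≤ ω y := fun y => Real.smoothTransition.nonneg _
  have hωV : ∀ y, fderiv ℝ ω y (V y) ≤ 0 := by
    intro y
    have hST : HasDerivAt Real.smoothTransition
        (deriv Real.smoothTransition (Hb y - t)) (Hb y - t) :=
      ((Real.smoothTransition.contDiff (n := 1)).differentiable one_ne_zero _).hasDerivAt
    have hHt : HasFDerivAt (fun z => Hb z - t) (fderiv ℝ Hb y) y :=
      (hHd y).hasFDerivAt.sub_const t
    have hωd : HasFDerivAt ω (deriv Real.smoothTransition (Hb y - t) • fderiv ℝ Hb y) y := by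
      have := hST.comp_hasFDerivAt y hHt
      exact this
    rw [hωd.fderiv, _root_.smul_apply, smul_eq_mul, hHV y]
    have h1 : 0 ≤ deriv Real.smoothTransition (Hb y - t) :=
      Real.smoothTransition.monotone.deriv_nonneg
    have h2 : (2 * γ - 1) * ‖V y‖ ^ 2 ≤ 0 :=
      mul_nonpos_of_nonpos_of_nonneg (by linarith) (sq_nonneg _)
    exact mul_nonpos_of_nonneg_of_nonpos h1 h2
  have hωt : ∀ y, 0 < ω y → t < Hb y := by
    intro y hy
    by_contra hle
    have : ω y = 0 := Real.smoothTransition.zero_of_nonpos (by linarith [not_lt.1 hle])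
    linarith
  have hball : ∀ R, R₀ ≤ R → ∀ y, ‖y - c‖ ≤ R → 0 < ω y → curl U y = 0 := by
    intro R hRR
    have hR : 0 < R := hR₀.trans_le hRR
    set K : Set (EuclideanSpace ℝ (Fin 3)) :=
      (closedBall c (2 * R) ∩ {y | t ≤ Hb y}) ∩ Dᶜ with hKdef
    have hKc : IsCompact K :=
      ((isCompact_closedBall c (2 * R)).inter_right (isClosed_le continuous_const hHc)).inter_right
        hDo.isClosed_compl
    have hVpos : ∀ y ∈ K, 0 < ‖V y‖ := by
      intro y hy
      rw [norm_pos_iff]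
      intro hV0
      have hyN : y ∈ N := ⟨hV0, hy.1.2⟩
      exact hy.2 (hND hyN)
    obtain ⟨cfl, hcfl, hcflle⟩ := hKc.exists_forall_le' hVc.norm.continuousOn hVpos
    obtain ⟨M₀, hM₀⟩ := (isCompact_closedBall c (2 * R)).exists_bound_of_continuousOn
      hDUc.continuousOn
    set M : ℝ := max M₀ 1 with hMdef
    have hM : ∀ y, ‖y - c‖ ≤ 2 * R → ‖fderiv ℝ U y‖ ≤ M := fun y hy =>
      (hM₀ y (by rw [mem_closedBall, dist_eq_norm]; exact hy)).trans (le_max_left _ _)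
    set lam : ℝ := (2 * a * M + 3 * γ + 1) / ((1 - 2 * γ) * cfl ^ 2) with hlamdef
    have hlam0 : 0 ≤ lam := by
      rw [hlamdef]
      apply div_nonneg
      · have : 0 ≤ 2 * a * M := by positivity
        linarith
      · have : 0 < 1 - 2 * γ := by linarith
        positivity
    have hlamK : 2 * a * (M - 1) + lam * ((2 * γ - 1) * cfl ^ 2) + 3 * γ ≤ -1 := by
      have hpos : 0 < (1 - 2 * γ) * cfl ^ 2 := by
        have : 0 < 1 - 2 * γ := by linarith
        positivity
      have e : lam * ((2 * γ - 1) * cfl ^ 2) = -(2 * a * M + 3 * γ + 1) := by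
        calc lam * ((2 * γ - 1) * cfl ^ 2)
            = -((2 * a * M + 3 * γ + 1) / ((1 - 2 * γ) * cfl ^ 2) * ((1 - 2 * γ) * cfl ^ 2)) := by
              rw [hlamdef]; ring
          _ = -(2 * a * M + 3 * γ + 1) := by rw [div_mul_cancel₀ _ hpos.ne']
      rw [e]
      have : 0 ≤ 2 * a := by linarith
      nlinarith
    set ψ : EuclideanSpace ℝ (Fin 3) → ℝ := fun y => lam * Hb y with hψdef
    have hψ1 : ContDiff ℝ 1 ψ := contDiff_const.mul hH1
    have hψV : ∀ y, fderiv ℝ ψ y (V y) = lam * ((2 * γ - 1) * ‖V y‖ ^ 2) := by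
      intro y
      rw [hψdef, fderiv_const_mul (hHd y), _root_.smul_apply, smul_eq_mul, hHV y]
    set m : EuclideanSpace ℝ (Fin 3) → ℝ := fun y => if y ∈ D then θ else M with hmdef
    have hm : ∀ y, ‖y - c‖ ≤ 2 * R →
        ⟪curl U y, fderiv ℝ U y (curl U y)⟫ ≤ m y * ‖curl U y‖ ^ 2 := by
      intro y hy
      by_cases hyD : y ∈ D
      · have hmy : m y = θ := if_pos hyD
        rw [hmy, real_inner_comm]
        exact hDθ y hyD _
      · have hmy : m y = M := if_neg hyD
        rw [hmy]
        calc ⟪curl U y, fderiv ℝ U y (curl U y)⟫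
            ≤ ‖curl U y‖ * ‖fderiv ℝ U y (curl U y)‖ := real_inner_le_norm _ _
          _ ≤ ‖curl U y‖ * (‖fderiv ℝ U y‖ * ‖curl U y‖) :=
              mul_le_mul_of_nonneg_left (ContinuousLinearMap.le_opNorm _ _) (norm_nonneg _)
          _ ≤ ‖curl U y‖ * (M * ‖curl U y‖) := by gcongr; exact hM y hy
          _ = M * ‖curl U y‖ ^ 2 := by ring
    have hbr : ∀ y, ‖y - c‖ ≤ 2 * R → 0 < ω y →
        2 * a * (m y - 1) + fderiv ℝ ψ y (selfSimilarTransport γ c U y) + 3 * γ ≤ -1 := by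
      intro y hy hωy
      have hty : t ≤ Hb y := (hωt y hωy).le
      rw [← hVdef, hψV y]
      by_cases hyD : y ∈ D
      · have hmy : m y = θ := if_pos hyD
        rw [hmy]
        have hneg : lam * ((2 * γ - 1) * ‖V y‖ ^ 2) ≤ 0 := by
          have : (2 * γ - 1) * ‖V y‖ ^ 2 ≤ 0 :=
            mul_nonpos_of_nonpos_of_nonneg (by linarith) (sq_nonneg _)
          exact mul_nonpos_of_nonneg_of_nonpos hlam0 this
        linarith
      · have hmy : m y = M := if_neg hyD
        rw [hmy]
        have hyK : y ∈ K := ⟨⟨by rw [mem_closedBall, dist_eq_norm]; exact hy, hty⟩, hyD⟩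
        have hVy : cfl ≤ ‖V y‖ := hcflle y hyK
        have hsq : cfl ^ 2 ≤ ‖V y‖ ^ 2 := pow_le_pow_left₀ hcfl.le hVy 2
        have hmono : lam * ((2 * γ - 1) * ‖V y‖ ^ 2) ≤ lam * ((2 * γ - 1) * cfl ^ 2) := by
          apply mul_le_mul_of_nonneg_left _ hlam0
          have : 2 * γ - 1 ≤ 0 := by linarith
          exact mul_le_mul_of_nonpos_left hsq this
        linarith
    have hout' : ∀ y, R ≤ ‖y - c‖ → 0 ≤ ⟪selfSimilarTransport γ c U y, y - c⟫ :=
      fun y hy => hfarout y (hRR.trans hy)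
    exact hVp.curl_eq_zero_of_weight_of_antitone ha1 hψ1 hω1 hω0 hωV hR hm hbr hout'
  intro y hy
  have hωy : 0 < ω y := Real.smoothTransition.pos_of_pos (by simp only [hHbdef]; linarith)
  exact hball (max R₀ ‖y - c‖) (le_max_left _ _) y (le_max_right _ _) hωy

/-- **Pointwise form under the far-field bounds.** Let `0 < γ < ½`, `(U, P)` a `C²` profile with
(3.8), `t ∈ ℝ`. If `⟪DU(z) w, w⟫ < |w|²` for all `w ≠ 0` at every stagnation point `z` with
`ℋ(z) ≥ t`, then `curl U = 0` on `{ℋ > t}` (the set of such stagnation points is compact, so the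
bound is uniform). In words: the vorticity of an in-window profile lives on and below the top
Bernoulli level of its stagnation points with a unit stretching rate.
[cite: ConstantinIgnatovaVicol2026Putative, §3.5 Thm. 3.10 (proof, sharpened and localised)] -/
theorem curl_eq_zero_on_bernoulliSuperlevel_of_hasSelfSimilarFarField
    (h : IsSelfSimilarEulerProfile γ c U P) (hγ : 0 < γ) (hγ2 : γ < 1 / 2) {C : ℝ}
    (hfar : HasSelfSimilarFarFieldWith γ c C U) (t : ℝ)
    (hnode : ∀ z ∈ selfSimilarNodalSet γ c U, t ≤ selfSimilarBernoulli γ c U P z →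
      ∀ w : EuclideanSpace ℝ (Fin 3), w ≠ 0 → ⟪fderiv ℝ U z w, w⟫ < ‖w‖ ^ 2) :
    ∀ y, t < selfSimilarBernoulli γ c U P y → curl U y = 0 := by
  have hU2 : ContDiff ℝ 2 U := h.contDiff_velocity
  have hDUc : Continuous (fderiv ℝ U) := hU2.continuous_fderiv (by norm_num)
  have hHc : Continuous (selfSimilarBernoulli γ c U P) := h.contDiff_selfSimilarBernoulli.continuous
  set N : Set (EuclideanSpace ℝ (Fin 3)) :=
    selfSimilarNodalSet γ c U ∩ {z | t ≤ selfSimilarBernoulli γ c U P z} with hNdef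
  have hNc : IsCompact N :=
    (hfar.isCompact_selfSimilarNodalSet hγ hU2.continuous).inter_right
      (isClosed_le continuous_const hHc)
  set S : Set (EuclideanSpace ℝ (Fin 3)) := sphere 0 1 with hSdef
  have hSc : IsCompact S := isCompact_sphere 0 1
  set F : EuclideanSpace ℝ (Fin 3) × EuclideanSpace ℝ (Fin 3) → ℝ :=
    fun p => 1 - ⟪fderiv ℝ U p.1 p.2, p.2⟫ with hFdef
  have hFc : Continuous F := by
    have h1 : Continuous fun p : EuclideanSpace ℝ (Fin 3) × EuclideanSpace ℝ (Fin 3) =>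
        fderiv ℝ U p.1 p.2 :=
      (hDUc.comp continuous_fst).clm_apply continuous_snd
    exact continuous_const.sub (h1.inner continuous_snd)
  have hFpos : ∀ p ∈ N ×ˢ S, (0 : ℝ) < F p := by
    rintro ⟨z, w⟩ ⟨hz, hw⟩
    have hw1 : ‖w‖ = 1 := by simpa [hSdef] using hw
    have hw0 : w ≠ 0 := by
      rw [← norm_ne_zero_iff, hw1]; exact one_ne_zero
    have := hnode z hz.1 hz.2 w hw0
    rw [hw1, one_pow] at this
    simp only [hFdef]
    linarith
  obtain ⟨a', ha', hle⟩ := (hNc.prod hSc).exists_forall_le' hFc.continuousOn hFpos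
  have hθ₀ : 1 - a' < 1 := by linarith
  have hnode' : ∀ z ∈ selfSimilarNodalSet γ c U, t ≤ selfSimilarBernoulli γ c U P z →
      ∀ w : EuclideanSpace ℝ (Fin 3), ⟪fderiv ℝ U z w, w⟫ ≤ (1 - a') * ‖w‖ ^ 2 := by
    intro z hz hzt w
    by_cases hw : w = 0
    · simp [hw]
    have hn : ‖w‖ ≠ 0 := norm_ne_zero_iff.2 hw
    set e : EuclideanSpace ℝ (Fin 3) := ‖w‖⁻¹ • w with he
    have he1 : ‖e‖ = 1 := by rw [he, norm_smul, norm_inv, norm_norm, inv_mul_cancel₀ hn]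
    have heS : e ∈ S := by simpa [hSdef] using he1
    have h1 := hle (z, e) ⟨⟨hz, hzt⟩, heS⟩
    simp only [hFdef] at h1
    have hwe : w = ‖w‖ • e := by rw [he, smul_smul, mul_inv_cancel₀ hn, one_smul]
    have h2 : ⟪fderiv ℝ U z w, w⟫ = ‖w‖ ^ 2 * ⟪fderiv ℝ U z e, e⟫ := by
      rw [hwe, map_smul, inner_smul_left, inner_smul_right, conj_trivial, norm_smul, norm_norm,
        he1, mul_one]
      ring
    rw [h2]
    nlinarith [sq_nonneg ‖w‖]
  obtain ⟨R₀, hR₀, hfarout⟩ := hfar.exists_inner_transport_nonneg hγ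
  exact h.curl_eq_zero_on_bernoulliSuperlevel hγ hγ2 t hθ₀ hnode' hR₀ hfarout

end IsSelfSimilarEulerProfile

end Literature.Analysis.FluidPDE

end
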